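import Literature.NumberTheory.EllipticCurves.SteinWuthrich2013.MultiplicativeLeadingTerm
import Literature.NumberTheory.EllipticCurves.CanonicalPAdicHeightAdmissibleProofs
import HarnessLib

/-!
# Stein–Wuthrich 2013 §4.2: EXISTENCE (named fact) and UNIQUENESS (proved) of the `p`-adic height
# datum at a multiplicative prime (`IsSplitMultCanonical` / `IsMultCanonical`)

Topic `Literature/NumberTheory/EllipticCurves` (cluster `SteinWuthrich2013`); companion of
`MultiplicativeLeadingTerm.lean` (x11a gen 7, p181807: Stein–Wuthrich 2013 Thm. 6.1 at a
multiplicative prime, with the §4.2 height PINNED by the predicates `IsSplitMultCanonical Dh Dq` /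
`IsMultCanonical Dh q`). HONEST FRAMING (BSD rank-`≤ 1` residual cell `b2b-bsdres`, literature seat
gen 6): the cell deletes the COMBINATION-SHAPED residual classes of the rank-`≤ 1` BSD formula
STRICTLY from published theorems and TYPES the remainder; nothing here is a class theorem and
nothing here is "finishing BSD".

**Why.** Every per-curve certificate theorem at a prime `p ‖ N`
(`Rank1Residual/Typed/PAdicCertificate{Multiplicative,ReducibleMultiplicative}Canonical.lean`,
p181868 / p181917) carries the binders `(Dh : PAdicHeightData W p) (hDh : IsSplitMultCanonical Dh Dq)`
(resp. `IsMultCanonical Dh q`) and a computed claim `hcert` about `padicRegulator Dh`. To APPLY such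
a theorem to a curve one must EXHIBIT a datum `Dh` — a symmetric bilinear torsion-vanishing pairing
on ALL of `E(ℚ)` whose quadratic form is the §4.2 formula on every admissible point. That is not a
finite computation (it is the quadraticity of the sigma height on infinitely many points); it is the
published EXISTENCE of the canonical (Schneider) `p`-adic height pairing at a multiplicative prime,
exactly as `WeierstrassCurve.exists_isCanonical` (`CanonicalPAdicHeight.lean`) is for a good
ordinary prime. This file vendors that existence statement as a NAMED FACT (two spellings, split /
non-split, matching the two predicates) and PROVES uniqueness, so that `∃!` holds and
`padicRegulator Dh` is a well-defined number — the one the lane computes.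

**Sources (held; page/line locators refer to the held copies).**
* W. Stein, C. Wuthrich, *Algorithms for the arithmetic of elliptic curves using Iwasawa theory*,
  Math. Comp. 82 (2013) 1757–1792 [held preprint `paper:url-055ad7d818a8`]: §4 p. 14 [p0014 L30–L45]
  "Bernardi [Ber81] proves that this function is quadratic and satisfies the parallelogram law. …
  it induces a bilinear symmetric pairing … the pairing is zero if one of the points is a torsion
  point"; §4.1 p. 15 [p0015 L5–L7] "We write `⟨·,·⟩_p` for the canonical `p`-adic height pairing on
  `E(ℚ)` associated to `ĥ_p`, and `Reg_p(E/ℚ)` for the discriminant of the height pairing on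
  `E(ℚ)/E(ℚ)_tor`"; §4.2 pp. 15–16 [p0015 L19 – p0016 L8] (the height at a multiplicative prime:
  non-split "we use the same formula (4.1)"; split `ĥ_p(P) = 2 log_p(e(P)/σ_p(t(P))) - log_p(u)²/log_p(q_E)`,
  "The `p`-adic regulator is formed as before but with this modified `p`-adic height `ĥ_p`");
  §6.1 p. 20 [p0020 L8–L11] "Note that it [Thm. 6.1] uses the analytic and algebraic `p`-adic height
  defined by Schneider in [Sch82]; taking into account the mentioned correction by Werner, these
  heights agree with the height in Section 4.2."
* A. Werner, *Local heights on abelian varieties and rigid analytic uniformization*, Doc. Math. 3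
  (1998) 301–319 [held `paper:doi-10-4171-dm-47`]: §2 p. 304 [p0004 L5–L10] (Schneider's
  norm-adapted `ρ`-splitting "exists … if `N A_K(K)` has finite index", [Sch1] = Schneider 1982);
  Thm. 6.1 / Thm. 6.2 p. 313 [p0013 L27–L40] (semistable ordinary reduction: "Schneider's local
  `p`-adic height exists iff our `ρ`-splitting … exists", i.e. iff `ρ` is `M`-invertible — for a
  Tate curve: iff `ρ(q) ≠ 0`); Cor. 7.3 p. 318 [p0018 L5–L16] (Tate curve, `ρ(q) ≠ 0`: the
  canonical Mazur–Tate splitting and Schneider's differ by `ρ(e)ρ(e')/(m_A m_{A'} ρ(q))` — "our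
  formula differs from the one in [MTT] by the factors `ord_v(q_v)` … the result in [MTT] needs a
  correction" — the correction SW §4.2 applies). With `ρ = log_p` (cyclotomic), `ρ(q_E) = log_p q_E ≠ 0`
  is Barré-Sirieix–Diaz–Gramain–Philibert (SW eq. (3.4) p. 11; tree fact `LInvariant_ne_zero`).
* P. Schneider, *`p`-adic height pairings I*, Invent. Math. 69 (1982) 401–409 (bib `Schneider1982`;
  not held — the existence/characterisation is read in Werner 1998 §2, §6 and SW 2013 §6.1).

**Faithfulness audit of the pinned formulas (literature seat gen 6, evidence only).** The
definitions `uniformisationScaleSq`, `logUnitParamSq`, `tateSigmaSq`, `coshOfSq`,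
`heightFourOneCoord`, `heightSplitCoord` of `MultiplicativeLeadingTerm.lean`, evaluated in exact /
`p`-adic arithmetic (pure python, cell home `b2b-bsdres-lit/g6/swcheck/`), reproduce the source's own
printed numbers for its running example `E₀ = 446d1`, `E₀(ℚ) = ℤ(2,0) ⊕ ℤ(1,-1)` (SW eq. (3.3)):
`𝓛_223 = 179·223 + 85·223² + 30·223³ + O(223⁴)` and
`Reg_223(E₀) = 153·223² + 125·223³ + 124·223⁴ + O(223⁵)` (SW §12.1 p. 29; split multiplicative),
the latter ONLY with the printed correction coefficient `-1` of `log_p(u)²/log_p(q_E)` among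
`{0, ±1, ±2, ±1/2}`; and formula (4.1) with SW's printed `E₂(E₀, ω)` reproduces
`Reg_5(E₀) = 2·5 + 2·5² + 5⁴ + 4·5⁵ + 2·5⁷ + 4·5⁸ + O(5⁹)` (SW eq. (4.2) p. 15). (The same
computation shows that the display "`e₂ = C²·(1 - 24 Σ σ₁(n) q_Eⁿ)`" on SW p. 15 should read
`C⁻²·(…)` for SW's own `ψ^*ω_E = C du/u` — weight-2 scaling; the tree's definitions use the product
formula for `σ_p(u)` and never `e₂`, so they are unaffected.)

## What is here

* `IsMultCanonical.unique`, `IsSplitMultCanonical.unique` (PROVED): two data satisfying the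
  predicate coincide (`PAdicHeightData.ext_of_sq_eq_on` + the tree THEOREM
  `exists_admissible_nsmul_holds`: every non-torsion point has an admissible multiple, any `p`);
  hence `padicRegulator` is the same for all such data (`…padicRegulator_eq`).
* `exists_isSplitMultCanonical`, `exists_isMultCanonical` (NAMED FACTS, nothing asserted):
  existence of the datum — SW 2013 §4.2 + §6.1 (= Schneider's `p`-adic height pairing, Schneider
  1982, which exists at a multiplicative prime by Werner 1998 Thm. 6.1/6.2 since `log_p q_E ≠ 0`, and
  agrees with the §4.2 formula on admissible points, Werner 1998 Cor. 7.3 / SW p. 20).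
* `existsUnique` corollaries (PROVED from the two items above).

## Design notes

* Hypotheses as in `thm61_{split,nonsplit}Multiplicative` (`p ≠ 2`; `W` globally minimal; split
  multiplicative reduction carried by `Dq : TateParameterData W p`; non-split by
  `HasMultiplicativeReductionAtPrime ∧ ¬ HasSplitMultiplicativeReductionAtPrime` and the Tate
  parameter `q` given with `q ≠ 0`, `‖q‖ < 1`, `j(q) = j(E)`), so that the existence facts discharge
  EXACTLY the binders `(Dh, hDh)` of the consumers. `p ≠ 2` is narrower than Schneider/Werner (any
  `p`) and matches SW §6 ("`p > 2`").
* No hypothesis `log_p q_E ≠ 0`: it is a theorem (BDGP 1996), cited by the source (SW (3.4)); the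
  tree's spelling `LInvariant_ne_zero` is a named fact that the consumers already carry (`h𝓛`).
* Not here (prover's side, `Rank1Residual/Typed/`): the `Dh`-free forms of the certificate theorems
  (`obtain ⟨Dh, hDh⟩ := exists_isSplitMultCanonical …`; the computed claim then reads
  `∀ Dh, IsSplitMultCanonical Dh Dq → hcert(padicRegulator Dh)`, one number by uniqueness).
-/

noncomputable section

open scoped Classical

open WeierstrassCurve

namespace Literature.NumberTheory.EllipticCurves.SteinWuthrich2013

/-! ### Uniqueness (proved) -/

section Unique

variable {W : WeierstrassCurve ℚ} [W.IsElliptic] [W.IsGloballyMinimal] {p : ℕ} [Fact p.Prime]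

/-- **Uniqueness of the §4.2 datum at a non-split multiplicative prime**: two symmetric bilinear
torsion-vanishing pairings on `E(ℚ)` whose quadratic forms agree with `heightFourOne W p q` on every
admissible point are equal (every non-torsion point has an admissible multiple —
`exists_admissible_nsmul_holds` —, scale by `m²` and polarise: `PAdicHeightData.ext_of_sq_eq_on`).
[Stein–Wuthrich 2013, §4 p. 14 ("induces a bilinear symmetric pairing") and §4.2; Mazur–Stein–Tate
2006, §1 ("extends uniquely")] [folklore] -/
theorem IsMultCanonical.unique {q : ℚ_[p]} {D₁ D₂ : PAdicHeightData W p}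
    (h₁ : IsMultCanonical D₁ q) (h₂ : IsMultCanonical D₂ q) : D₁ = D₂ :=
  PAdicHeightData.ext_of_sq_eq_on {P | W.IsAdmissible p P} (exists_admissible_nsmul_holds W p)
    fun Q hQ => by rw [h₁ Q hQ, h₂ Q hQ]

/-- **Uniqueness of the §4.2 datum at a split multiplicative prime** (same argument with
`heightSplit W p Dq`). [Stein–Wuthrich 2013, §4.2 (p. 16)] [folklore] -/
theorem IsSplitMultCanonical.unique {Dq : TateParameterData W p} {D₁ D₂ : PAdicHeightData W p}
    (h₁ : IsSplitMultCanonical D₁ Dq) (h₂ : IsSplitMultCanonical D₂ Dq) : D₁ = D₂ :=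
  PAdicHeightData.ext_of_sq_eq_on {P | W.IsAdmissible p P} (exists_admissible_nsmul_holds W p)
    fun Q hQ => by rw [h₁ Q hQ, h₂ Q hQ]

/-- The `p`-adic regulator of the §4.2 height at a non-split multiplicative prime is a well-defined
number: any two data satisfying `IsMultCanonical · q` have the same regulator. [folklore] -/
theorem IsMultCanonical.padicRegulator_eq {q : ℚ_[p]} {D₁ D₂ : PAdicHeightData W p}
    (h₁ : IsMultCanonical D₁ q) (h₂ : IsMultCanonical D₂ q) :
    padicRegulator D₁ = padicRegulator D₂ := by
  rw [h₁.unique h₂]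

/-- The `p`-adic regulator of the §4.2 height at a split multiplicative prime is a well-defined
number. [folklore] -/
theorem IsSplitMultCanonical.padicRegulator_eq {Dq : TateParameterData W p}
    {D₁ D₂ : PAdicHeightData W p} (h₁ : IsSplitMultCanonical D₁ Dq)
    (h₂ : IsSplitMultCanonical D₂ Dq) : padicRegulator D₁ = padicRegulator D₂ := by
  rw [h₁.unique h₂]

end Unique

/-! ### Existence (named facts, nothing asserted) -/

/-- **Existence of the Stein–Wuthrich §4.2 `p`-adic height at a SPLIT multiplicative prime**
(= Schneider's `p`-adic height pairing). Let `E/ℚ` be an elliptic curve with globally minimal model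
`W` and `p ≠ 2` a prime of split multiplicative reduction, carried by the Tate parameter datum `Dq`
(`q = q_E`). Then there is a symmetric bilinear torsion-vanishing pairing `Dh` on `E(ℚ)` with values
in `ℚ_p` (a `PAdicHeightData W p`) whose quadratic form on every admissible point `P` (non-torsion,
trivial reduction at `p`, `z(P)` in the sigma disc, non-singular reduction at every prime) is SW's
modified height `ĥ_p(P) = 2 log_p(e(P)/σ_p(t(P))) - log_p(u)²/log_p(q_E)` (`IsSplitMultCanonical Dh Dq`,
i.e. `Dh.pairing P P = heightSplit W p Dq P`). As printed: SW §4.1–4.2 "We write `⟨·,·⟩_p` for the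
canonical `p`-adic height pairing on `E(ℚ)` associated to `ĥ_p` … The `p`-adic regulator is formed
as before but with this modified `p`-adic height `ĥ_p`"; §6.1 p. 20 "it uses the analytic and
algebraic `p`-adic height defined by Schneider in [Sch82]; taking into account the mentioned
correction by Werner, these heights agree with the height in Section 4.2" — Schneider's pairing is a
symmetric bilinear pairing on `E(ℚ)` (Schneider 1982), it exists at a split multiplicative prime
because `log_p q_E ≠ 0` (Werner 1998 Thm. 6.1/6.2: for semistable ordinary reduction Schneider's
local height exists iff `ρ` is `M`-invertible, for a Tate curve iff `ρ(q) ≠ 0`; `ρ = log_p`, BDGP),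
and on Tate curves it differs from the canonical Mazur–Tate (sigma) height by the term
`ρ(e)ρ(e')/(m m' ρ(q))` (Werner 1998 Cor. 7.3, correcting MTT 1986 §II.6 p. 34), which is SW's
correction `-log_p(u)²/log_p(q_E)`. Named fact (the multiplicative analogue of
`WeierstrassCurve.exists_isCanonical`); unique by `IsSplitMultCanonical.unique`.
[cite: SteinWuthrich2013, §4.1 (p. 15 L5–L7), §4.2 (pp. 15–16), §6.1 (p. 20 L8–L11)]
[cite: Werner1998, Thm. 6.1, Thm. 6.2 (p. 313), Cor. 7.3 (p. 318)]
[cite: Schneider1982, §1 (existence of the norm-adapted height)] -/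
def exists_isSplitMultCanonical : Prop :=
  ∀ (W : WeierstrassCurve ℚ) [W.IsElliptic] [W.IsGloballyMinimal] (p : ℕ) [Fact p.Prime],
    p ≠ 2 → ∀ Dq : TateParameterData W p, ∃ Dh : PAdicHeightData W p, IsSplitMultCanonical Dh Dq

/-- **Existence of the Stein–Wuthrich §4.2 `p`-adic height at a NON-SPLIT multiplicative prime**
(= Schneider's `p`-adic height pairing = the canonical Mazur–Tate sigma height, formula (4.1):
"If the reduction is nonsplit multiplicative, we use the same formula (4.1) to define the `p`-adic
height as for the good ordinary case", SW §4.2 p. 15). For `E/ℚ` with globally minimal `W`, `p ≠ 2`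
a prime of non-split multiplicative reduction and `q` the Tate parameter of `E/ℚ_p` (`q ≠ 0`,
`‖q‖_p < 1`, `j(q) = j(E)`), there is a `PAdicHeightData W p` whose quadratic form on admissible
points is `heightFourOne W p q` (`IsMultCanonical Dh q`). Sources and status as for
`exists_isSplitMultCanonical` (at a non-split prime the Werner correction term vanishes on
`E(ℚ_p)`: the Tate-uniformisation parameter of a `ℚ_p`-point has norm `1` in the unramified
quadratic extension, so `ρ(e) = log_p N(u) = 0`; SW accordingly use (4.1) unchanged). Named fact;
unique by `IsMultCanonical.unique`.
[cite: SteinWuthrich2013, §4.2 (p. 15 L25–L26), §6.1 (p. 20 L8–L11)]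
[cite: Werner1998, Thm. 6.1, Thm. 6.2 (p. 313), Cor. 7.3 (p. 318)] -/
def exists_isMultCanonical : Prop :=
  ∀ (W : WeierstrassCurve ℚ) [W.IsElliptic] [W.IsGloballyMinimal] (p : ℕ) [Fact p.Prime],
    p ≠ 2 → W.HasMultiplicativeReductionAtPrime p → ¬ W.HasSplitMultiplicativeReductionAtPrime p →
    ∀ (q : ℚ_[p]), q ≠ 0 → ‖q‖ < 1 → tateJ q = (W.j : ℚ_[p]) →
      ∃ Dh : PAdicHeightData W p, IsMultCanonical Dh q

/-! ### Consequences: `∃!` -/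

section Consequences

variable {W : WeierstrassCurve ℚ} [W.IsElliptic] [W.IsGloballyMinimal] {p : ℕ} [Fact p.Prime]

/-- Projection of the existence fact: THE §4.2 datum at a split multiplicative prime `p ≠ 2` exists
and is unique (existence = the hypothesis `h`, a named fact; uniqueness proved). Not a discharge of
the fact. [Stein–Wuthrich 2013, §4.2] [folklore] -/
theorem exists_isSplitMultCanonical.existsUnique (h : exists_isSplitMultCanonical) (hp : p ≠ 2)
    (Dq : TateParameterData W p) : ∃! Dh : PAdicHeightData W p, IsSplitMultCanonical Dh Dq := by
  obtain ⟨Dh, hDh⟩ := h W p hp Dq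
  exact ⟨Dh, hDh, fun D' hD' => hD'.unique hDh⟩

/-- Projection of the existence fact: THE §4.2 datum at a non-split multiplicative prime `p ≠ 2`
exists and is unique (existence = the hypothesis `h`; uniqueness proved). Not a discharge of the
fact. [Stein–Wuthrich 2013, §4.2] [folklore] -/
theorem exists_isMultCanonical.existsUnique (h : exists_isMultCanonical) (hp : p ≠ 2)
    (hmult : W.HasMultiplicativeReductionAtPrime p)
    (hns : ¬ W.HasSplitMultiplicativeReductionAtPrime p) {q : ℚ_[p]} (hq0 : q ≠ 0) (hq1 : ‖q‖ < 1)
    (hj : tateJ q = (W.j : ℚ_[p])) :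
    ∃! Dh : PAdicHeightData W p, IsMultCanonical Dh q := by
  obtain ⟨Dh, hDh⟩ := h W p hp hmult hns q hq0 hq1 hj
  exact ⟨Dh, hDh, fun D' hD' => hD'.unique hDh⟩

end Consequences

end Literature.NumberTheory.EllipticCurves.SteinWuthrich2013

end
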